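import Summits.HodgeConjecture.HodgeConjecture.Theorems.SignSymmetricPowersSixFacts
import Literature.AlgebraicGeometry.FundamentalGroup.HypersurfaceComplementMeridiansGenerate
import HarnessLib

/-!
# Crux K1-B `VeryGeneralSignCommutatorsInHg` and the rung leaf `SignThreefoldPowersHodge` modulo FIVE cited facts —
# Zariski–van Kampen generation (ZvK) being a theorem (route `SignSymmetricPowers`,
# items stmt-HodgeConjecture-19716 / 19715)

Prover seat `hodge-nonav-prover-Ax` (g6), cell `hodge-nonav`, 2026-08-28. Landed `--supports stmt-HodgeConjecture-19716
--as helper`; sorry-free, no definition, no new named fact. CONDITIONAL results; nothing here says HC ∕ HC_AV is proved;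
rung F-H1 is not moved.

`SignSymmetricPowersSixFacts.veryGeneralSignCommutatorsInHg_of_six_facts` (seat Bx g7) closes K1-B from SIX cited facts
{hV Voisin's equivariant eigen-Hodge numbers, hZvK Zariski–van Kampen meridian generation, hPL the Picard–Lefschetz
formula for one-nodal degenerations, hGIC Deligne's global invariant cycles, hCDK the Cattani–Deligne–Kaplan cover, hB2
Picard–Lefschetz for a symmetric `A₃` pair}. The second — ZvK,
`Literature.AlgebraicGeometry.FundamentalGroup.affineHypersurfaceComplement_meridians_normalClosure_eq_top` (Shimada
2010 Prop. 3.4 for `ℂ^ι`: for irreducible `h₁, …, hₘ`, `π₁(ℂ^ι ∖ ⋃ V(hⱼ), s)` is the normal closure of one meridian per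
component) — is now the tree THEOREM `affineHypersurfaceComplement_meridians_normalClosure_eq_top_holds`
(`Literature/AlgebraicGeometry/FundamentalGroup/HypersurfaceComplementMeridiansGenerate.lean`, this seat: generic base
point by resultants and Baire, line subdivision of loops, lassos of punctured lines normally generate and are meridians
along good lines, transport of the base point, meridian conjugacy). Hence:

* `veryGeneralSignCommutatorsInHg_of_five_facts` — **K1-B ⟸ {hV, hPL, hGIC, hCDK, hB2}**;
* `signThreefoldPowersHodge_of_five_facts` — the rung leaf likewise;
* `veryGeneralSignCommutatorsInHg_of_five_facts_kernel` / `…_primitive` — the same with hV replaced by Griffiths'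
  residue-kernel package `Griffiths1969_residueKernel_eq_jacobianIdeal`, resp. by the residue package with primitivity
  `Griffiths1969_residues_primitive` (G5, the residue fact shared with the cyclic K1 crux of the cell).

With G5 the union of the cited inputs of the cell's two F-H1 K1 cruxes is now
{CT99 Picard–Lefschetz package, CT99 §5 eigen-Hodge numbers ∕ G5, CDK, PL, GIC, B2}.

## References

* [Shimada2010ZvK] I. Shimada, Generalized Zariski–van Kampen theorem and its application to Grassmannian dual varieties,
  Int. J. Math. 21 (2010), §3 Prop. 3.4.
* [VoisinHodgeII2003] C. Voisin, Hodge Theory and Complex Algebraic Geometry II (2003), §6.1.3 Thm. 6.10 / Cor. 6.12;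
  Ch. 2–3 (Lefschetz pencils, Picard–Lefschetz, Zariski's theorem).
* [Deligne1971HodgeII] P. Deligne, Théorie de Hodge II, Publ. Math. IHÉS 40 (1971), 4.1.1 (global invariant cycles).
* [CattaniDeligneKaplan1995] E. Cattani, P. Deligne, A. Kaplan, On the locus of Hodge classes, J. Amer. Math. Soc. 8
  (1995), Thm. 1.1, Cor. 1.2.
-/

noncomputable section

open Literature.AlgebraicGeometry.Motives Literature.AlgebraicGeometry.HodgeTheory
open Literature.AlgebraicGeometry.FundamentalGroup (affineHypersurfaceComplement_meridians_normalClosure_eq_top_holds)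

-- mandated namespace `Summit.HodgeConjecture.HodgeConjecture.Theorems` trips `linter.dupNamespace` (off tree-wide)
set_option linter.dupNamespace false

namespace Summit.HodgeConjecture.HodgeConjecture.Theorems.SignSymmetricPowersFiveFacts

/-- **Crux K1-B `VeryGeneralSignCommutatorsInHg` modulo FIVE cited facts** {hV, hPL, hGIC, hCDK, hB2}: the six-fact
closing composition with ZvK supplied by the tree theorem
`affineHypersurfaceComplement_meridians_normalClosure_eq_top_holds`. CONDITIONAL; nothing here says HC ∕ HC_AV is
proved. [cite: Shimada2010ZvK, §3 Prop. 3.4] [cite: VoisinHodgeII2003, §6.1.3 Thm. 6.10 and Cor. 6.12]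
[cite: CattaniDeligneKaplan1995, Thm. 1.1 and Cor. 1.2] -/
theorem veryGeneralSignCommutatorsInHg_of_five_facts
    (hV : Literature.AlgebraicGeometry.HodgeTheory.voisin2003_finrank_eigenspace_inf_hodgePiece_of_diagonalStabilizer)
    (hPL : Literature.AlgebraicGeometry.HodgeTheory.picardLefschetz_nodalForms_uniform)
    (hGIC : Literature.AlgebraicGeometry.HodgeTheory.deligne_globalInvariantCycles)
    (hCDK : Literature.AlgebraicGeometry.HodgeTheory.cmsp_nonHodgeGenericPoints_countable_algebraic_cover)
    (hB2 : Literature.AlgebraicGeometry.HodgeTheory.picardLefschetz_symmetricA3) :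
    Summit.HodgeConjecture.HodgeConjecture.Theses.SignSymmetricPowers.VeryGeneralSignCommutatorsInHg :=
  SignSymmetricPowersSixFacts.veryGeneralSignCommutatorsInHg_of_six_facts @hV
    affineHypersurfaceComplement_meridians_normalClosure_eq_top_holds @hPL @hGIC @hCDK @hB2

/-- **The rung leaf `SignThreefoldPowersHodge` modulo the same FIVE cited facts.** CONDITIONAL; rung F-H1 not moved.
[cite: Shimada2010ZvK, §3 Prop. 3.4] [cite: VoisinHodgeII2003, §6.1.3 Thm. 6.10 and Cor. 6.12]
[cite: CattaniDeligneKaplan1995, Thm. 1.1 and Cor. 1.2] -/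
theorem signThreefoldPowersHodge_of_five_facts
    (hV : Literature.AlgebraicGeometry.HodgeTheory.voisin2003_finrank_eigenspace_inf_hodgePiece_of_diagonalStabilizer)
    (hPL : Literature.AlgebraicGeometry.HodgeTheory.picardLefschetz_nodalForms_uniform)
    (hGIC : Literature.AlgebraicGeometry.HodgeTheory.deligne_globalInvariantCycles)
    (hCDK : Literature.AlgebraicGeometry.HodgeTheory.cmsp_nonHodgeGenericPoints_countable_algebraic_cover)
    (hB2 : Literature.AlgebraicGeometry.HodgeTheory.picardLefschetz_symmetricA3) :
    Summit.HodgeConjecture.HodgeConjecture.Theses.SignSymmetricPowers.SignThreefoldPowersHodge :=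
  SignSymmetricPowersSixFacts.signThreefoldPowersHodge_of_six_facts @hV
    affineHypersurfaceComplement_meridians_normalClosure_eq_top_holds @hPL @hGIC @hCDK @hB2

/-- **K1-B modulo FIVE facts, residue-kernel form**: hV replaced by Griffiths' residue-kernel package (Voisin II
Thm. 6.10). CONDITIONAL. [cite: Shimada2010ZvK, §3 Prop. 3.4] [cite: VoisinHodgeII2003, §6.1.3 Thm. 6.10 and Cor. 6.12]
[cite: CattaniDeligneKaplan1995, Thm. 1.1 and Cor. 1.2] -/
theorem veryGeneralSignCommutatorsInHg_of_five_facts_kernel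
    (hG : Literature.AlgebraicGeometry.HodgeTheory.Griffiths1969_residueKernel_eq_jacobianIdeal)
    (hPL : Literature.AlgebraicGeometry.HodgeTheory.picardLefschetz_nodalForms_uniform)
    (hGIC : Literature.AlgebraicGeometry.HodgeTheory.deligne_globalInvariantCycles)
    (hCDK : Literature.AlgebraicGeometry.HodgeTheory.cmsp_nonHodgeGenericPoints_countable_algebraic_cover)
    (hB2 : Literature.AlgebraicGeometry.HodgeTheory.picardLefschetz_symmetricA3) :
    Summit.HodgeConjecture.HodgeConjecture.Theses.SignSymmetricPowers.VeryGeneralSignCommutatorsInHg :=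
  SignSymmetricPowersSixFacts.veryGeneralSignCommutatorsInHg_of_six_facts_kernel @hG
    affineHypersurfaceComplement_meridians_normalClosure_eq_top_holds @hPL @hGIC @hCDK @hB2

/-- **K1-B modulo FIVE facts, residue-package form** (G5, the residue fact shared by the two F-H1 K1 cruxes).
CONDITIONAL. [cite: Shimada2010ZvK, §3 Prop. 3.4] [cite: VoisinHodgeII2003, §6.1.3 Thm. 6.10 and Cor. 6.12, §6.1.2 Thm. 6.5]
[cite: CattaniDeligneKaplan1995, Thm. 1.1 and Cor. 1.2] -/
theorem veryGeneralSignCommutatorsInHg_of_five_facts_primitive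
    (hG5 : Literature.AlgebraicGeometry.HodgeTheory.Griffiths1969_residues_primitive)
    (hPL : Literature.AlgebraicGeometry.HodgeTheory.picardLefschetz_nodalForms_uniform)
    (hGIC : Literature.AlgebraicGeometry.HodgeTheory.deligne_globalInvariantCycles)
    (hCDK : Literature.AlgebraicGeometry.HodgeTheory.cmsp_nonHodgeGenericPoints_countable_algebraic_cover)
    (hB2 : Literature.AlgebraicGeometry.HodgeTheory.picardLefschetz_symmetricA3) :
    Summit.HodgeConjecture.HodgeConjecture.Theses.SignSymmetricPowers.VeryGeneralSignCommutatorsInHg :=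
  SignSymmetricPowersSixFacts.veryGeneralSignCommutatorsInHg_of_six_facts_primitive @hG5
    affineHypersurfaceComplement_meridians_normalClosure_eq_top_holds @hPL @hGIC @hCDK @hB2

end Summit.HodgeConjecture.HodgeConjecture.Theorems.SignSymmetricPowersFiveFacts

end
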